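import Summits.QuantumFields.BalabanUV.Beta.GAN24.FaceWordFullDeep
import Summits.QuantumFields.BalabanUV.Beta.GAN24.FaceWordEEDiagDeep
import Summits.QuantumFields.BalabanUV.Beta.GAN24.FaceWordSwapGeneric

/-!
# `BalabanUV.Beta.GAN24.FaceWordFullDeepPatterns` — binder row G-an2-4 ∕ (CONV-C), W-slot (α-0), typer's PART VI row **T6-VAL**, the (γ) hand's letter **K7-a AT LEVELS `≥ 1`, ALL PATTERNS**:
# the levels-`j+1` twin of this hand's `FaceWordFullZeroPatterns` — for the FULL level-`j+1` stencil table at the W-locus pins (`FaceWordFullDeep`'s table: E-sector amplitude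
# `Lc^{d+1}·wE d Lc (j+1)`, VH sector `−½Lc^{2(d+1)}·wVH d Lc (j+1)`, gauge sector `cΛ` free) composed with the level-`j+1` dressed step at the deep period `Lc·N`: the direct exchange face word
# VANISHES on the left (`α = μ`) and right (`β = ν`) diagonals (lineage g56's `FaceWordEEDiagDeep` through the null-sector junction), the SWAPPED word is VALUED for `ν ≠ α`, `μ ≠ β` by
# `FaceWordFullDeep.faceWordFull_deep_value` with the bond directions exchanged (`FaceWordSwapGeneric`), and vanishes on its diagonals `ν = α`, `μ = β` — the eight inputs of
# `CrossedFromThreeWords.crossed_of_threeWords` at levels `≥ 1`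
# (G-an2-4 CRUX TEAM (2), seat `b2b-balaban-gan24-formalise-leaf-06` = the (γ) hand, gen 57; journal [GAN24LEAF06-G57-INTENT-8])

NOT IN PRINT; OUR BOOKKEEPING ([folklore]: this hand's `FaceWordFullDeep`, `FaceWordNullSector.faceWord_eq_cellPairing_of_null`, `FaceWordVHNullCurrents`, `FaceWordSwapGeneric.swapWord_eq_directWord`
and lineage g56's `FaceWordEEDeep` ∕ `FaceWordEEDiagDeep` BY NAME; the text is `FaceWordFullZeroPatterns` with `0 ↦ j+1`; 0 `def`, 0 cited fact, 0 `def … : Prop`, 0 sorry).  HONEST FRAMING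
(cell contract, verbatim): «discharging `BetaPertH` makes Bałaban's UV stability UNCONDITIONAL — a real constructive-QFT result; it is NOT the continuum limit and NOT the Clay problem.»  HONEST
DEPENDENCY (verbatim): «continuum YM on T⁴ ⇐ BetaPertH ∧ nine spine estimates (0/9 proved); BetaPertH ⇐ (D1) ∧ (D4) ∧ CAP+tail; G-an2-4 gates asym, D1 and NE2/3/4.»  The W-locus pins of
the table are an INPUT (road-P2 ∕ leaf-03 keep `cVH` free: flagged, memo §5); discharges NOTHING of `hX` ∕ `hXu` ∕ (C) ∕ `hB0` ∕ `hBF` ∕ (Q-L); NEVER «G-an2-4 closed» as (CONV-C); NOT D1,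
NOT `BetaPertH`, NOT continuum, NOT Clay.  2026-08-24; no existing file touched.
-/

noncomputable section

open Finset
open scoped BigOperators
open Literature.MathematicalPhysics.QuantumFieldTheory
open Literature.MathematicalPhysics.QuantumFieldTheory.Balaban1983to89
open Literature.MathematicalPhysics.QuantumFieldTheory.Balaban1983to89.Beta
open ExpKernelCalculus (Site MKer Decays BiLoc shiftK comp)
open OneStepResolventKernel (Fib LocStencil decays_mono)
open OneStepKernelFamily (KInvStep)
open BalabanStepJets (locStencil_mono)
open StepJetData (locStencil_smul locStencil_add)
open AffineAveraging (box toSite)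
open AveragingHessianKernelsRooted (vhSAt locStencil_vhSAt vhSAt_translate)
open BalabanStepJetsSucc (E2 wVH wE)
open Summit.QuantumFields.BalabanUV.Beta.AxialDressingRooted (coDressKBmAt one_le_of_neZero decays_coDressKBmAt_KInvStep)
open Summit.QuantumFields.BalabanUV.Beta.HessKerDressedUnits (unitK unitS unitS_apply locStencil_unitS decays_unitK)
open Summit.QuantumFields.BalabanUV.Beta.SpineRooted (SpureRecAt e3OfK SpureRecAt_succ SpureRecAt_translate)
open Summit.QuantumFields.BalabanUV.Beta.WardLocusRecursive (SrecAt)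
open Summit.QuantumFields.BalabanUV.Beta.GAN24.FaceWordNullSector (faceWord_eq_cellPairing_of_null)
open Summit.QuantumFields.BalabanUV.Beta.GAN24.FaceWordVHNullCurrents (vhSector_nullL vhSector_nullR)
open Summit.QuantumFields.BalabanUV.Beta.GAN24.FaceWordEEDeep (sectorE_inr_left sectorE_inr_right exists_common_rate dressedStep_invariant_deep)
open Summit.QuantumFields.BalabanUV.Beta.GAN24.FaceWordEEValueDeep (cellPairing_deep_value_units)

open Summit.QuantumFields.BalabanUV.Beta.GAN24.FaceWordFullDeep (fullTableSucc_split fullTableSucc_translate exists_common_rate_fullSucc faceWordFull_deep_value)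
open Summit.QuantumFields.BalabanUV.Beta.GAN24.FaceWordEEDiagDeep (cellPairing_deep_eq_zero_of_left_diag_units cellPairing_deep_eq_zero_of_right_diag_units)
open Summit.QuantumFields.BalabanUV.Beta.GAN24.FaceWordSwapGeneric (swapWord_eq_directWord)

namespace Summit.QuantumFields.BalabanUV.Beta.GAN24.FaceWordFullDeepPatterns

variable {d : ℕ} {Lc : ℕ} [NeZero Lc] {r : Fin (d + 1) → ℕ}

/-- NOT IN PRINT; OUR BOOKKEEPING.  **LEFT DIAGONAL (`α = μ`), FULL LEVEL-`j+1` TABLE AT THE W-LOCUS PINS: the direct exchange face word is `0`.** -/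
theorem faceWordFull_deep_eq_zero_of_left_diag (hr : r ∈ box (d + 1) Lc) (sf sm cΛ : ℝ) (j N : ℕ) [NeZero N] (μ ν β : Fin (d + 1)) :
    ∑ rr ∈ box (d + 1) (Lc * N), ∑' t : Site (d + 1),
        (if toSite rr μ % ((Lc * N : ℕ) : ℤ) = ((Lc * N : ℕ) : ℤ) - 1 then (1 : ℝ) else 0) * (if t ν % ((Lc * N : ℕ) : ℤ) = ((Lc * N : ℕ) : ℤ) - 1 then (1 : ℝ) else 0) *
        ∑' yw : Site (d + 1) × Site (d + 1),
          (if yw.1 μ % ((Lc * N : ℕ) : ℤ) = ((Lc * N : ℕ) : ℤ) - 1 then (1 : ℝ) else 0) * (if yw.2 β % ((Lc * N : ℕ) : ℤ) = ((Lc * N : ℕ) : ℤ) - 1 then (1 : ℝ) else 0) *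
          comp (comp (unitS sf sm (SpureRecAt d Lc (toSite r) ((Lc : ℝ) ^ (d + 1)) (-((Lc : ℝ) ^ (d + 1) * (1 / 2) * (Lc : ℝ) ^ (d + 1))) cΛ (j + 1)) μ (toSite rr))
            (unitK sf sm (coDressKBmAt (toSite r) Lc (KInvStep (d := d) Lc (j + 1)))))
            (unitS sf sm (SpureRecAt d Lc (toSite r) ((Lc : ℝ) ^ (d + 1)) (-((Lc : ℝ) ^ (d + 1) * (1 / 2) * (Lc : ℝ) ^ (d + 1))) cΛ (j + 1)) ν t)
            yw.1 yw.2 (Sum.inl μ) (Sum.inl β) = 0 := by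
  have hLc : 1 ≤ Lc := one_le_of_neZero Lc
  haveI : NeZero (Lc * N) := ⟨Nat.mul_ne_zero (NeZero.ne Lc) (NeZero.ne N)⟩
  obtain ⟨Cs, Cs₁, Cs₂, CX, m, hm, hS, hS₁, hS₂, hX⟩ := exists_common_rate_fullSucc (d := d) hr sf sm cΛ j
  rw [faceWord_eq_cellPairing_of_null (N := Lc * N) hS hS₁ hS₂ hX hm
      (fun κ t s => by
        have h := fullTableSucc_translate (Lc := Lc) (r := r) sf sm cΛ j κ t ((N : ℤ) • s)
        rwa [smul_smul, ← Nat.cast_mul] at h)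
      (fun s => dressedStep_invariant_deep (Lc := Lc) (r := r) sf sm j N s)
      (fun κ t => fullTableSucc_split (Lc := Lc) (r := r) sf sm cΛ j κ t)
      (fun κ t y x m' b => sectorE_inr_left (Lc := Lc) (r := r) sf sm ((Lc : ℝ) ^ (d + 1) * wE d Lc (j + 1)) cΛ j κ t y x m' b)
      (fun κ t y x a m' => sectorE_inr_right (Lc := Lc) (r := r) sf sm ((Lc : ℝ) ^ (d + 1) * wE d Lc (j + 1)) cΛ j κ t y x a m') μ ν μ β
      (fun x f => vhSector_nullL (d := d) hLc hr N sf sm ((-((Lc : ℝ) ^ (d + 1) * (1 / 2) * (Lc : ℝ) ^ (d + 1))) * wVH d Lc (j + 1)) μ μ x f)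
      (fun z g => vhSector_nullR (d := d) hLc hr N sf sm ((-((Lc : ℝ) ^ (d + 1) * (1 / 2) * (Lc : ℝ) ^ (d + 1))) * wVH d Lc (j + 1)) ν β z g)]
  exact cellPairing_deep_eq_zero_of_left_diag_units hr sf sm ((Lc : ℝ) ^ (d + 1) * wE d Lc (j + 1)) cΛ j N μ ν β


/-- NOT IN PRINT; OUR BOOKKEEPING.  **RIGHT DIAGONAL (`β = ν`), FULL LEVEL-`j+1` TABLE: the direct exchange face word is `0`.** -/
theorem faceWordFull_deep_eq_zero_of_right_diag (hr : r ∈ box (d + 1) Lc) (sf sm cΛ : ℝ) (j N : ℕ) [NeZero N] (μ α ν : Fin (d + 1)) :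
    ∑ rr ∈ box (d + 1) (Lc * N), ∑' t : Site (d + 1),
        (if toSite rr μ % ((Lc * N : ℕ) : ℤ) = ((Lc * N : ℕ) : ℤ) - 1 then (1 : ℝ) else 0) * (if t ν % ((Lc * N : ℕ) : ℤ) = ((Lc * N : ℕ) : ℤ) - 1 then (1 : ℝ) else 0) *
        ∑' yw : Site (d + 1) × Site (d + 1),
          (if yw.1 α % ((Lc * N : ℕ) : ℤ) = ((Lc * N : ℕ) : ℤ) - 1 then (1 : ℝ) else 0) * (if yw.2 ν % ((Lc * N : ℕ) : ℤ) = ((Lc * N : ℕ) : ℤ) - 1 then (1 : ℝ) else 0) *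
          comp (comp (unitS sf sm (SpureRecAt d Lc (toSite r) ((Lc : ℝ) ^ (d + 1)) (-((Lc : ℝ) ^ (d + 1) * (1 / 2) * (Lc : ℝ) ^ (d + 1))) cΛ (j + 1)) μ (toSite rr))
            (unitK sf sm (coDressKBmAt (toSite r) Lc (KInvStep (d := d) Lc (j + 1)))))
            (unitS sf sm (SpureRecAt d Lc (toSite r) ((Lc : ℝ) ^ (d + 1)) (-((Lc : ℝ) ^ (d + 1) * (1 / 2) * (Lc : ℝ) ^ (d + 1))) cΛ (j + 1)) ν t)
            yw.1 yw.2 (Sum.inl α) (Sum.inl ν) = 0 := by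
  have hLc : 1 ≤ Lc := one_le_of_neZero Lc
  haveI : NeZero (Lc * N) := ⟨Nat.mul_ne_zero (NeZero.ne Lc) (NeZero.ne N)⟩
  obtain ⟨Cs, Cs₁, Cs₂, CX, m, hm, hS, hS₁, hS₂, hX⟩ := exists_common_rate_fullSucc (d := d) hr sf sm cΛ j
  rw [faceWord_eq_cellPairing_of_null (N := Lc * N) hS hS₁ hS₂ hX hm
      (fun κ t s => by
        have h := fullTableSucc_translate (Lc := Lc) (r := r) sf sm cΛ j κ t ((N : ℤ) • s)
        rwa [smul_smul, ← Nat.cast_mul] at h)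
      (fun s => dressedStep_invariant_deep (Lc := Lc) (r := r) sf sm j N s)
      (fun κ t => fullTableSucc_split (Lc := Lc) (r := r) sf sm cΛ j κ t)
      (fun κ t y x m' b => sectorE_inr_left (Lc := Lc) (r := r) sf sm ((Lc : ℝ) ^ (d + 1) * wE d Lc (j + 1)) cΛ j κ t y x m' b)
      (fun κ t y x a m' => sectorE_inr_right (Lc := Lc) (r := r) sf sm ((Lc : ℝ) ^ (d + 1) * wE d Lc (j + 1)) cΛ j κ t y x a m') μ ν α ν
      (fun x f => vhSector_nullL (d := d) hLc hr N sf sm ((-((Lc : ℝ) ^ (d + 1) * (1 / 2) * (Lc : ℝ) ^ (d + 1))) * wVH d Lc (j + 1)) μ α x f)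
      (fun z g => vhSector_nullR (d := d) hLc hr N sf sm ((-((Lc : ℝ) ^ (d + 1) * (1 / 2) * (Lc : ℝ) ^ (d + 1))) * wVH d Lc (j + 1)) ν ν z g)]
  exact cellPairing_deep_eq_zero_of_right_diag_units hr sf sm ((Lc : ℝ) ^ (d + 1) * wE d Lc (j + 1)) cΛ j N μ α ν


/-- NOT IN PRINT; OUR BOOKKEEPING.  **THE SWAPPED EXCHANGE FACE WORD OF THE FULL LEVEL-`j+1` TABLE, VALUED** (`ν ≠ α`, `μ ≠ β`): K4a's bond swap (`FaceWordSwapGeneric`) then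
`FaceWordFullDeep.faceWordFull_deep_value` with the bond directions exchanged. -/
theorem faceWordFull_swap_deep_value (hr : r ∈ box (d + 1) Lc) (sf sm cΛ : ℝ) (j N : ℕ) [NeZero N] {μ α ν β : Fin (d + 1)} (hνα : ν ≠ α) (hμβ : μ ≠ β) :
    ∑ rr ∈ box (d + 1) (Lc * N), ∑' t : Site (d + 1),
        (if toSite rr μ % ((Lc * N : ℕ) : ℤ) = ((Lc * N : ℕ) : ℤ) - 1 then (1 : ℝ) else 0) * (if t ν % ((Lc * N : ℕ) : ℤ) = ((Lc * N : ℕ) : ℤ) - 1 then (1 : ℝ) else 0) *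
        ∑' yw : Site (d + 1) × Site (d + 1),
          (if yw.1 α % ((Lc * N : ℕ) : ℤ) = ((Lc * N : ℕ) : ℤ) - 1 then (1 : ℝ) else 0) * (if yw.2 β % ((Lc * N : ℕ) : ℤ) = ((Lc * N : ℕ) : ℤ) - 1 then (1 : ℝ) else 0) *
          comp (comp (unitS sf sm (SpureRecAt d Lc (toSite r) ((Lc : ℝ) ^ (d + 1)) (-((Lc : ℝ) ^ (d + 1) * (1 / 2) * (Lc : ℝ) ^ (d + 1))) cΛ (j + 1)) ν t)
            (unitK sf sm (coDressKBmAt (toSite r) Lc (KInvStep (d := d) Lc (j + 1)))))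
            (unitS sf sm (SpureRecAt d Lc (toSite r) ((Lc : ℝ) ^ (d + 1)) (-((Lc : ℝ) ^ (d + 1) * (1 / 2) * (Lc : ℝ) ^ (d + 1))) cΛ (j + 1)) μ (toSite rr))
            yw.1 yw.2 (Sum.inl α) (Sum.inl β) =
      (((sf * sm)⁻¹ * (sf⁻¹ * sf⁻¹) * ((Lc : ℝ) ^ (d + 1) * wE d Lc (j + 1))) * ((sf * sm)⁻¹ * (sf⁻¹ * sf⁻¹) * ((Lc : ℝ) ^ (d + 1) * wE d Lc (j + 1)))) *
      ((-(1 / 2 : ℝ)) * (1 / 2 : ℝ) * ((sf * sf) *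
        ((wVH d Lc (j + 1))⁻¹ *
            ∑ x ∈ box (d + 1) (Lc * N), ∑ b : Fin (d + 1),
              ((if b = ν then ((((Lc * N : ℕ) : ℝ))⁻¹ * (((Lc * N : ℕ) : ℝ))⁻¹) * ((((toSite x α % ((Lc * N : ℕ) : ℤ) : ℤ) : ℝ) - ((((Lc * N : ℕ) : ℝ)) - 1) / 2)) else 0)
                + (if b = α then (-(((Lc * N : ℕ) : ℝ))⁻¹ * ((((toSite x ν % ((Lc * N : ℕ) : ℤ) : ℤ) : ℝ) - ((((Lc * N : ℕ) : ℝ)) - 1) / 2))) *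
                    (if toSite x α % ((Lc * N : ℕ) : ℤ) = ((Lc * N : ℕ) : ℤ) - 1 then (1 : ℝ) else 0) else 0)) *
              ∑' s : Site (d + 1), ∑ b' : Fin (d + 1), E2 d Lc (j + 1) (toSite x) s (Sum.inl b) (Sum.inl b') *
                ((if b' = μ then ((((Lc * N : ℕ) : ℝ))⁻¹ * (((Lc * N : ℕ) : ℝ))⁻¹) * ((((s β % ((Lc * N : ℕ) : ℤ) : ℤ) : ℝ) - ((((Lc * N : ℕ) : ℝ)) - 1) / 2)) else 0)
                  + (if b' = β then (-(((Lc * N : ℕ) : ℝ))⁻¹ * ((((s μ % ((Lc * N : ℕ) : ℤ) : ℤ) : ℝ) - ((((Lc * N : ℕ) : ℝ)) - 1) / 2))) *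
                      (if s β % ((Lc * N : ℕ) : ℤ) = ((Lc * N : ℕ) : ℤ) - 1 then (1 : ℝ) else 0) else 0)) -
          (wVH d Lc (j + 1))⁻¹ * (((Lc : ℝ) ^ (d + 1) * (Lc : ℝ) ^ (d + 1)) *
            ∑ y ∈ box (d + 1) N, ∑ a : Fin (d + 1),
              ((if a = ν then (((N : ℝ))⁻¹ * ((N : ℝ))⁻¹) * ((((toSite y α % (N : ℤ)) : ℤ) : ℝ) - ((N : ℝ) - 1) / 2) else 0)
                + (if a = α then (-((N : ℝ))⁻¹ * ((((toSite y ν % (N : ℤ)) : ℤ) : ℝ) - ((N : ℝ) - 1) / 2)) *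
                    (if toSite y α % (N : ℤ) = (N : ℤ) - 1 then (1 : ℝ) else 0) else 0)) *
              ∑' s : Site (d + 1), ∑ b' : Fin (d + 1), E2 d Lc (j + 2) (toSite y) s (Sum.inl a) (Sum.inl b') *
                ((if b' = μ then (((N : ℝ))⁻¹ * ((N : ℝ))⁻¹) * ((((s β % (N : ℤ)) : ℤ) : ℝ) - ((N : ℝ) - 1) / 2) else 0)
                  + (if b' = β then (-((N : ℝ))⁻¹ * ((((s μ % (N : ℤ)) : ℤ) : ℝ) - ((N : ℝ) - 1) / 2)) *
                      (if s β % (N : ℤ) = (N : ℤ) - 1 then (1 : ℝ) else 0) else 0)))))) := by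
  haveI : NeZero (Lc * N) := ⟨Nat.mul_ne_zero (NeZero.ne Lc) (NeZero.ne N)⟩
  obtain ⟨Cs, Cs₁, Cs₂, CX, m, hm, hS, hS₁, hS₂, hX⟩ := exists_common_rate_fullSucc (d := d) hr sf sm cΛ j
  rw [swapWord_eq_directWord (N := Lc * N) hS hX hm
      (fun κ t s => by
        have h := fullTableSucc_translate (Lc := Lc) (r := r) sf sm cΛ j κ t ((N : ℤ) • s)
        rwa [smul_smul, ← Nat.cast_mul] at h)
      (fun s => dressedStep_invariant_deep (Lc := Lc) (r := r) sf sm j N s) μ ν α β]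
  exact faceWordFull_deep_value hr sf sm cΛ j N hνα hμβ


/-- NOT IN PRINT; OUR BOOKKEEPING.  **THE SWAPPED WORD VANISHES FOR `ν = α`** (its left current is diagonal). -/
theorem faceWordFull_swap_deep_eq_zero_of_left_diag (hr : r ∈ box (d + 1) Lc) (sf sm cΛ : ℝ) (j N : ℕ) [NeZero N] (μ ν β : Fin (d + 1)) :
    ∑ rr ∈ box (d + 1) (Lc * N), ∑' t : Site (d + 1),
        (if toSite rr μ % ((Lc * N : ℕ) : ℤ) = ((Lc * N : ℕ) : ℤ) - 1 then (1 : ℝ) else 0) * (if t ν % ((Lc * N : ℕ) : ℤ) = ((Lc * N : ℕ) : ℤ) - 1 then (1 : ℝ) else 0) *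
        ∑' yw : Site (d + 1) × Site (d + 1),
          (if yw.1 ν % ((Lc * N : ℕ) : ℤ) = ((Lc * N : ℕ) : ℤ) - 1 then (1 : ℝ) else 0) * (if yw.2 β % ((Lc * N : ℕ) : ℤ) = ((Lc * N : ℕ) : ℤ) - 1 then (1 : ℝ) else 0) *
          comp (comp (unitS sf sm (SpureRecAt d Lc (toSite r) ((Lc : ℝ) ^ (d + 1)) (-((Lc : ℝ) ^ (d + 1) * (1 / 2) * (Lc : ℝ) ^ (d + 1))) cΛ (j + 1)) ν t)
            (unitK sf sm (coDressKBmAt (toSite r) Lc (KInvStep (d := d) Lc (j + 1)))))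
            (unitS sf sm (SpureRecAt d Lc (toSite r) ((Lc : ℝ) ^ (d + 1)) (-((Lc : ℝ) ^ (d + 1) * (1 / 2) * (Lc : ℝ) ^ (d + 1))) cΛ (j + 1)) μ (toSite rr))
            yw.1 yw.2 (Sum.inl ν) (Sum.inl β) = 0 := by
  haveI : NeZero (Lc * N) := ⟨Nat.mul_ne_zero (NeZero.ne Lc) (NeZero.ne N)⟩
  obtain ⟨Cs, Cs₁, Cs₂, CX, m, hm, hS, hS₁, hS₂, hX⟩ := exists_common_rate_fullSucc (d := d) hr sf sm cΛ j
  rw [swapWord_eq_directWord (N := Lc * N) hS hX hm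
      (fun κ t s => by
        have h := fullTableSucc_translate (Lc := Lc) (r := r) sf sm cΛ j κ t ((N : ℤ) • s)
        rwa [smul_smul, ← Nat.cast_mul] at h)
      (fun s => dressedStep_invariant_deep (Lc := Lc) (r := r) sf sm j N s) μ ν ν β]
  exact faceWordFull_deep_eq_zero_of_left_diag hr sf sm cΛ j N ν μ β


/-- NOT IN PRINT; OUR BOOKKEEPING.  **THE SWAPPED WORD VANISHES FOR `μ = β`** (its right current is diagonal). -/
theorem faceWordFull_swap_deep_eq_zero_of_right_diag (hr : r ∈ box (d + 1) Lc) (sf sm cΛ : ℝ) (j N : ℕ) [NeZero N] (μ ν α : Fin (d + 1)) :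
    ∑ rr ∈ box (d + 1) (Lc * N), ∑' t : Site (d + 1),
        (if toSite rr μ % ((Lc * N : ℕ) : ℤ) = ((Lc * N : ℕ) : ℤ) - 1 then (1 : ℝ) else 0) * (if t ν % ((Lc * N : ℕ) : ℤ) = ((Lc * N : ℕ) : ℤ) - 1 then (1 : ℝ) else 0) *
        ∑' yw : Site (d + 1) × Site (d + 1),
          (if yw.1 α % ((Lc * N : ℕ) : ℤ) = ((Lc * N : ℕ) : ℤ) - 1 then (1 : ℝ) else 0) * (if yw.2 μ % ((Lc * N : ℕ) : ℤ) = ((Lc * N : ℕ) : ℤ) - 1 then (1 : ℝ) else 0) *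
          comp (comp (unitS sf sm (SpureRecAt d Lc (toSite r) ((Lc : ℝ) ^ (d + 1)) (-((Lc : ℝ) ^ (d + 1) * (1 / 2) * (Lc : ℝ) ^ (d + 1))) cΛ (j + 1)) ν t)
            (unitK sf sm (coDressKBmAt (toSite r) Lc (KInvStep (d := d) Lc (j + 1)))))
            (unitS sf sm (SpureRecAt d Lc (toSite r) ((Lc : ℝ) ^ (d + 1)) (-((Lc : ℝ) ^ (d + 1) * (1 / 2) * (Lc : ℝ) ^ (d + 1))) cΛ (j + 1)) μ (toSite rr))
            yw.1 yw.2 (Sum.inl α) (Sum.inl μ) = 0 := by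
  haveI : NeZero (Lc * N) := ⟨Nat.mul_ne_zero (NeZero.ne Lc) (NeZero.ne N)⟩
  obtain ⟨Cs, Cs₁, Cs₂, CX, m, hm, hS, hS₁, hS₂, hX⟩ := exists_common_rate_fullSucc (d := d) hr sf sm cΛ j
  rw [swapWord_eq_directWord (N := Lc * N) hS hX hm
      (fun κ t s => by
        have h := fullTableSucc_translate (Lc := Lc) (r := r) sf sm cΛ j κ t ((N : ℤ) • s)
        rwa [smul_smul, ← Nat.cast_mul] at h)
      (fun s => dressedStep_invariant_deep (Lc := Lc) (r := r) sf sm j N s) μ ν α μ]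
  exact faceWordFull_deep_eq_zero_of_right_diag hr sf sm cΛ j N ν α μ

end Summit.QuantumFields.BalabanUV.Beta.GAN24.FaceWordFullDeepPatterns

end
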